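import Summits.BirchSwinnertonDyer.BirchSwinnertonDyer.Theorems.SchneiderFreeAdditiveX3JointLowerManin
import Summits.BirchSwinnertonDyer.BirchSwinnertonDyer.Theorems.SchneiderFreeAdditiveX3HeegnerTwistEqualities
import HarnessLib

/-!
# Route `SchneiderFreeAdditiveX3` (rung K1 door), item `JointLowerManin` (stmt-BirchSwinnertonDyer-19180):
# the REGISTERED BC3 stubs `stub_shaSplitting_heegner`, `stub_grossZagier_jointIndexIdentity_manin`
# verbatim, and the registered composition — sorry-free

Seat `bsd-schneider-door-c5` (cell `bsd-schneider-ideate`), gen 3. The item `JointLowerManin` was closed by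
gen 0 (`schneiderFreeAdditiveX3_jointLowerManin_proof`) through two INEQUALITIES, bypassing the three stubs
registered on the item by the planner's BC3 skeleton (`JointLowerManin_birth_route.lean`, sha256
`a5c1d69e…`, namespace `…Cruxes.JointLowerManin.Birth`; all three still `active`, none landed). This file
proves them AS REGISTERED (name + signature) — they are the EQUALITY forms, valid at EVERY odd prime:

* `stub_shaSplitting_heegner` — `ord_p #Ш(E/K) = ord_p #Ш(E) + ord_p #Ш(E^{d_K})`: Kolyvagin over `K`
  (the Heegner point is non-torsion by hypothesis) + descent + GZK for the rank-`0` twist + the odd-`p`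
  splitting `#Ш(E_K)[p^∞] = #Ш(E)[p^∞]·#Ш(E^{(d_K)})[p^∞]` (`card_primaryComponent_sha_baseChange_quadratic_of_odd_of_finite`);
* `stub_grossZagier_jointIndexIdentity_manin` — `#Ш_an(E) = q`, `#Ш_an(E^{d_K}) = q_d ∈ ℚ`,
  `ord_p q + ord_p q_d + ord_p ∏c(E) + ord_p ∏c(E^{d_K}) + 2·v_p(c) = 2·ord_p [E(K):ℤP]`: gen 0's
  Manin-robust identity `exists_shaAn_padicVal_eq_of_heegner_manin` + `#Ш_an(Wd)` in rank zero
  (`Wuthrich2014.shaAn_eq_of_L_one_div_eq`) + `v_p(u) = 0` at every odd `p`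
  (`padicValRat_u_eq_zero_of_twist_minimal_of_heegner_odd`);
* (`stub_tamagawa_twist_heegner_odd` — `ord_p ∏c(E^{d_K}) = ord_p ∏c(E)`, no `p ∤ d_K` — is landed in
  `…HeegnerTwistEqualities.lean` next to its arithmetic);
* `jointLowerManin_of_stubs` — the skeleton's composition `JointLowerManin_of` re-run on them (STEP L with
  slack `2·v_p(c)`; the slack CANCELS), concluding the route decl `JointLowerManin` by name.

The printed facts stay binders (Gross–Zagier, Kolyvagin, GZK, modularity, Gross–Zagier I.(7.3)); nothing
asserted; the item is already closed — this file discharges its registered line. HONEST FRAMING: BSD is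
not advanced by any of this.

References: [JetchevSkinnerWan2017] §7.3.1 (eq:tamK), §7.4.1 (eq:gz for K′), (eq:shalowerK-1)
(arXiv:1512.06894 pp. 29–31); [GrossZagier1986] I.(6.3), I.(7.3) 2), V.§2; [Gross1991] Thm. 1.3;
[DokchitserDokchitserAnnals2010] Lemma 4.14.
-/

set_option autoImplicit false
-- project-wide summit namespace `Summit.BirchSwinnertonDyer.BirchSwinnertonDyer.…` (summit = problem) trips the linter
set_option linter.dupNamespace false

noncomputable section

open scoped Classical

open IsDedekindDomain NumberField Rat.HeightOneSpectrum WeierstrassCurve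
  Literature.NumberTheory.EllipticCurves Literature.NumberTheory.EllipticCurves.ModularForms
  Literature.NumberTheory.QuadraticFields Literature.NumberTheory.EllipticCurves.Rank1Residual
  Literature.NumberTheory.EllipticCurves.Rank1Residual.Typed
  Summit.BirchSwinnertonDyer.Rank1Residual
  Summit.BirchSwinnertonDyer.BirchSwinnertonDyer.Theses.SchneiderFreeAdditiveX3

namespace Summit.BirchSwinnertonDyer.BirchSwinnertonDyer.Theorems.SchneiderFree

/-! ### The registered stubs 1 and 2 of the BC3 skeleton `a5c1d69e…`, verbatim, and the registered composition -/

/-- **STUB 1 of the registered skeleton (`stub_shaSplitting_heegner`), PROVED**: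
`ord_p #Ш(E/K) = ord_p #Ш(E) + ord_p #Ш(E^{d_K})` at the odd prime `p` for the Heegner data of the
item. Finiteness: Kolyvagin over `K` (the Heegner point `P` is non-torsion by hypothesis), descent to
`Ш(E/ℚ)` (`shaFinite_of_baseChange`), Gross–Zagier–Kolyvagin over `ℚ` for the rank-`0` twist `Wd`;
then the odd-`p` splitting `#Ш(E_K)[p^∞] = #Ш(E)[p^∞]·#Ш(E^{(d_K)})[p^∞]`
(`card_primaryComponent_sha_baseChange_quadratic_of_odd_of_finite`). The binders Gross–Zagier,
modularity, `r_an = 1`, `p ∤ #𝓞_K^×`, `L(E^{d_K},1) ≠ 0` of the registered signature are not needed.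
[cite: JetchevSkinnerWan2017, §7.4.1 (arXiv:1512.06894 p. 30)] [cite: Gross1991, Thm. 1.3] -/
theorem stub_shaSplitting_heegner :
    (∀ (N : ℕ) [NeZero N] (W : WeierstrassCurve ℚ) (K : Type) [Field K] [NumberField K], gross_zagier N W K) →
      (∀ (N : ℕ) [NeZero N] (W : WeierstrassCurve ℚ) (K : Type) [Field K] [NumberField K], kolyvagin N W K) →
      rank_eq_analyticRank_of_analyticRank_le_one → WeierstrassCurve.hasEntireLFunction_rat →
      ∀ (W : WeierstrassCurve ℚ) [W.IsElliptic] [W.IsGloballyMinimal] (p : ℕ) [Fact p.Prime]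
        (N : ℕ) [NeZero N] (K : Type) [Field K] [NumberField K]
        (Dt : ModularParametrizationData W N) (H : HeegnerDatum N (NumberField.discr K)) (ι : K →+* ℂ)
        (P : (W.baseChange K).toAffine.Point) (Wd : WeierstrassCurve ℚ) [Wd.IsElliptic]
        [Wd.IsGloballyMinimal],
        W.analyticRank = 1 → W.conductorNorm ℤ = N → IsImaginaryQuadratic K →
        Odd (NumberField.discr K) → ¬ p ∣ Units.torsionOrder K → SatisfiesHeegnerHypothesis N K →
        (W.quadraticTwist (NumberField.discr K : ℚ)).entireLFunction 1 ≠ 0 →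
        WeierstrassCurve.Affine.Point.map ι.toRatAlgHom P = heegnerPointComplex Dt H →
        ¬ IsOfFinAddOrder P →
        (∃ C : VariableChange ℚ, C • W.quadraticTwist (NumberField.discr K : ℚ) = Wd) →
        Wd.analyticRank = 0 → p ≠ 2 →
        padicValNat p (W.baseChange K).shaOrder = padicValNat p W.shaOrder + padicValNat p Wd.shaOrder := by
  intro _hGZ hKo hGZK _hmod W _ _ p _ N _ K _ _ Dt H ι P Wd _ _ _hr _hN hK _hodd _hμ hH _hLt hP hnt hWd
    hrd hp2
  have hpp : p.Prime := Fact.out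
  haveI hEK : (W.baseChange K).IsElliptic := by rw [baseChange]; infer_instance
  -- finiteness of the three Tate–Shafarevich groups
  have hPH : IsHeegnerPoint N W K P := ⟨Dt, H, ι, hP⟩
  obtain ⟨-, hShaK⟩ := hKo N W K hK hH hPH hnt
  haveI hfinK : Finite (W.baseChange K).sha := hShaK
  haveI hfinW : Finite W.sha := shaFinite_of_baseChange W K hShaK
  have hrd1 : Wd.analyticRank ≤ 1 := by rw [hrd]; exact zero_le_one
  obtain ⟨-, hShad⟩ := hGZK Wd hrd1
  haveI hfind : Finite Wd.sha := hShad
  -- the odd-`p` splitting of `Ш[p^∞]` under quadratic base change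
  have hcard := card_primaryComponent_sha_baseChange_quadratic_of_odd_of_finite W K hK.1 Wd hWd
    (W.baseChange K) ⟨1, one_smul _ _⟩ p hp2
  rw [WeierstrassCurve.shaOrder, WeierstrassCurve.shaOrder, WeierstrassCurve.shaOrder,
    ← (Nat.pow_right_injective hpp.two_le).eq_iff, pow_add,
    ← natCard_primaryComponent_eq_pow_padicValNat p, ← natCard_primaryComponent_eq_pow_padicValNat p,
    ← natCard_primaryComponent_eq_pow_padicValNat p]
  exact hcard

/-- **STUB 2 of the registered skeleton (`stub_grossZagier_jointIndexIdentity_manin`), PROVED** — the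
Gross–Zagier index identity in JOINT form WITH the parametrisation constant, as an EQUALITY at every odd
`p`: `#Ш_an(E) = q`, `#Ш_an(E^{d_K}) = q_d ∈ ℚ` and
`ord_p q + ord_p q_d + ord_p ∏c(E) + ord_p ∏c(E^{d_K}) + 2·v_p(c) = 2·ord_p [E(K):ℤP]`.
Gen 0's Manin-robust identity `exists_shaAn_padicVal_eq_of_heegner_manin` (with `v_p(c)` and
`v_p(u)` carried; the twist's central value `L(E^{d_K},1)/Ω ∈ ℚ` from Gross–Zagier I.(7.3) 2),
`exists_rat_twist_L_one_div_realPeriod_of_heegner`), the rank-zero reading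
`#Ш_an(Wd) = (L(Wd,1)/Ω)·#Wd(ℚ)²/∏c(Wd)` (`Wuthrich2014.shaAn_eq_of_L_one_div_eq`), and `v_p(u) = 0`
at every odd `p` (§2). Cassels and the parametrisation-datum binders are not needed.
[cite: GrossZagier1986, Thm. I.(6.3), I.(7.3) 2) and V.§2 (pp. 310–312)]
[cite: JetchevSkinnerWan2017, §7.4.1 (eq:gz for K′), §7.3.1 (eq:tamK)] -/
theorem stub_grossZagier_jointIndexIdentity_manin :
    (∀ (N : ℕ) [NeZero N] (W : WeierstrassCurve ℚ) (K : Type) [Field K] [NumberField K], gross_zagier N W K) →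
      (∀ (N : ℕ) [NeZero N] (W : WeierstrassCurve ℚ) (K : Type) [Field K] [NumberField K], kolyvagin N W K) →
      rank_eq_analyticRank_of_analyticRank_le_one → WeierstrassCurve.hasEntireLFunction_rat →
      nonempty_modularParametrizationData → WeierstrassCurve.bsdRHS_eq_of_isIsogenous →
      GrossZagier1986_thm_I_7_3 →
      ∀ (W : WeierstrassCurve ℚ) [W.IsElliptic] [W.IsGloballyMinimal] (p : ℕ) [Fact p.Prime]
        (N : ℕ) [NeZero N] (K : Type) [Field K] [NumberField K]
        (Dt : ModularParametrizationData W N) (H : HeegnerDatum N (NumberField.discr K)) (ι : K →+* ℂ)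
        (P : (W.baseChange K).toAffine.Point) (Wd : WeierstrassCurve ℚ) [Wd.IsElliptic]
        [Wd.IsGloballyMinimal],
        W.analyticRank = 1 → W.conductorNorm ℤ = N → IsImaginaryQuadratic K →
        Odd (NumberField.discr K) → ¬ p ∣ Units.torsionOrder K → SatisfiesHeegnerHypothesis N K →
        (W.quadraticTwist (NumberField.discr K : ℚ)).entireLFunction 1 ≠ 0 →
        WeierstrassCurve.Affine.Point.map ι.toRatAlgHom P = heegnerPointComplex Dt H →
        ¬ IsOfFinAddOrder P →
        (∃ C : VariableChange ℚ, C • W.quadraticTwist (NumberField.discr K : ℚ) = Wd) →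
        Wd.analyticRank = 0 → p ≠ 2 →
        ∃ q qd : ℚ, shaAn W = (q : ℂ) ∧ shaAn Wd = (qd : ℂ) ∧
          padicValRat p q + padicValRat p qd + (padicValNat p W.tamagawaProduct : ℤ) +
              (padicValNat p Wd.tamagawaProduct : ℤ) + 2 * (padicValNat p Dt.c.natAbs : ℤ) =
            2 * (padicValNat p (AddSubgroup.zmultiples P).index : ℤ) := by
  intro hGZ hKo hGZK hmod _hmodD _hCas hGZ73 W _ _ p _ N _ K _ _ Dt H ι P Wd _ _ hr hN hK hodd hμ hH hLt hP
    _hnt hWd _hrd hp2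
  obtain ⟨Cd, hCd⟩ := hWd
  -- the twist's algebraic central value (Gross–Zagier I.(7.3))
  obtain ⟨qd, hqd⟩ := exists_rat_twist_L_one_div_realPeriod_of_heegner W N K Dt H ι P
    (hGZ N W K) (hKo N W K) hGZK hmod hGZ73 hK hH hP hr hLt Wd Cd hCd
  -- the Manin-robust bookkeeping identity (carries `v_p(c)` and `v_p(u)`)
  obtain ⟨-, -, -, q, hq, hval⟩ := exists_shaAn_padicVal_eq_of_heegner_manin W p N K
    Dt H ι P (hGZ N W K) (hKo N W K) hGZK hmod hK hH hP hp2 hμ hr hLt Wd Cd hCd qd hqd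
  -- `#Ш_an(E^{d_K})` in rank zero
  have hD0 : (NumberField.discr K : ℚ) ≠ 0 := by exact_mod_cast NumberField.discr_ne_zero K
  haveI : (W.quadraticTwist (NumberField.discr K : ℚ)).IsElliptic := W.isElliptic_quadraticTwist hD0
  have hLd1 : Wd.entireLFunction 1 ≠ 0 := by rw [← hCd, entireLFunction_smul]; exact hLt
  obtain ⟨-, hfin, -, hshaAnd⟩ := Wuthrich2014.shaAn_eq_of_L_one_div_eq hGZK Wd hLd1 hqd
  haveI := hfin
  have htdeq : Wd.torsionOrder = Nat.card Wd.toAffine.Point := Wd.torsionOrder_eq_natCard_of_finite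
  -- the twist-model unit at EVERY odd `p` (§2)
  have hHN' : SatisfiesHeegnerHypothesis (W.conductorNorm ℤ) K := by rw [hN]; exact hH
  have hu : padicValRat p (Cd.u : ℚ) = 0 :=
    padicValRat_u_eq_zero_of_twist_minimal_of_heegner_odd W p hp2 K hK hodd hHN' Cd hCd
  refine ⟨q, qd * (Nat.card Wd.toAffine.Point : ℚ) ^ 2 / (Wd.tamagawaProduct : ℚ), hq, hshaAnd, ?_⟩
  -- valuation of `#Ш_an(E^{d_K})`
  have hqd0 : qd ≠ 0 := by
    intro h0
    apply hLd1
    have hΩ : (Wd.realPeriodRat : ℂ) ≠ 0 := by exact_mod_cast Wd.realPeriodRat_pos_holds.ne'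
    rw [h0, Rat.cast_zero, div_eq_zero_iff] at hqd
    exact hqd.resolve_right hΩ
  have htd0 : (Nat.card Wd.toAffine.Point : ℚ) ≠ 0 := by exact_mod_cast (Nat.card_pos).ne'
  have hcd0 : (Wd.tamagawaProduct : ℚ) ≠ 0 := by exact_mod_cast Wd.tamagawaProduct_pos_holds.ne'
  have hvd : padicValRat p (qd * (Nat.card Wd.toAffine.Point : ℚ) ^ 2 / (Wd.tamagawaProduct : ℚ)) =
      padicValRat p qd + 2 * padicValNat p Wd.torsionOrder - padicValNat p Wd.tamagawaProduct := by
    rw [padicValRat.div (mul_ne_zero hqd0 (pow_ne_zero _ htd0)) hcd0,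
      padicValRat.mul hqd0 (pow_ne_zero _ htd0), padicValRat.pow, padicValRat.of_nat, padicValRat.of_nat,
      htdeq]
    push_cast; ring
  rw [hvd]
  linarith

/-- **The registered skeleton's composition, re-run on the three proved stubs** (the term of
`JointLowerManin_of` in `JointLowerManin_birth_route.lean`, sha256 `a5c1d69e…`): STEP L WITH SLACK
`2·v_p(c)` + STUB 2's identity + STUB 1's splitting + STUB 3's Tamagawa equality give the joint lower
half — `v(q) + v(q_d) = 2v(I) − 2v(c) − v(c_W) − v(c_d) ≤ v(Ш_K) + 2v(c_W) + 2v(c) − 2v(c) − v(c_W) − v(c_d)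
= v(Ш_W) + v(Ш_d)`: the Manin slack CANCELS. The item is already closed by gen 0's
`schneiderFreeAdditiveX3_jointLowerManin_proof` (inequality version); this is the registered line,
now sorry-free. [cite: JetchevSkinnerWan2017, §7.4.1 (eq:shalowerK-1) (arXiv:1512.06894 p. 30)] -/
theorem jointLowerManin_of_stubs : JointLowerManin := by
  intro hGZ hKo hGZK hmod hmodD hCas hGZ73 W _ _ p _ N _ K _ _ Dt H ι P Wd _ _ hr hN hK hodd hμ hH hLt hP hnt hWd
    hrd hp2 hL
  have hsplit := stub_shaSplitting_heegner hGZ hKo hGZK hmod W p N K Dt H ι P Wd hr hN hK hodd hμ hH hLt hP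
    hnt hWd hrd hp2
  obtain ⟨q, qd, hq, hqd, hid⟩ := stub_grossZagier_jointIndexIdentity_manin hGZ hKo hGZK hmod hmodD hCas
    hGZ73 W p N K Dt H ι P Wd hr hN hK hodd hμ hH hLt hP hnt hWd hrd hp2
  have htam := stub_tamagawa_twist_heegner_odd W p N K Wd hN hK hodd hH hWd hp2
  refine ⟨q, qd, hq, hqd, ?_⟩
  have e1 : (2 * padicValNat p (AddSubgroup.zmultiples P).index : ℤ) ≤
      padicValNat p (W.baseChange K).shaOrder + 2 * padicValNat p W.tamagawaProduct +
        2 * (padicValNat p Dt.c.natAbs : ℤ) := by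
    unfold IndexLowerBoundLeAt at hL
    exact_mod_cast hL
  have e2 : (padicValNat p (W.baseChange K).shaOrder : ℤ) =
      padicValNat p W.shaOrder + padicValNat p Wd.shaOrder := by exact_mod_cast hsplit
  have e3 : (padicValNat p Wd.tamagawaProduct : ℤ) = padicValNat p W.tamagawaProduct := by
    exact_mod_cast htam
  linarith

end Summit.BirchSwinnertonDyer.BirchSwinnertonDyer.Theorems.SchneiderFree

end
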